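import Summits.ResolutionOfSingularities.ResolutionOfSingularities.Theorems.HilbertSamuelEliminationSigmaMaxModificationsCorridor3RegularCentresPermissible
import Literature.AlgebraicGeometry.Resolution.HypersurfacePushforward
import Literature.AlgebraicGeometry.Resolution.MaxStratumStrictTransform
import Literature.AlgebraicGeometry.Resolution.StrictTransformDistinct
import Literature.AlgebraicGeometry.Resolution.BlowupChartMembership
import Literature.AlgebraicGeometry.Resolution.HilbertSamuelSemicontinuitySharp
import HarnessLib

/-!
# Route `HilbertSamuelElimination`, crux `SigmaMaxModificationsCorridor3`
# (stmt-ResolutionOfSingularities-19249; child of `SigmaMaxModifications` stmt-…-18506),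
# line `tame_wild` v3 — PUSHING A BLOW-UP SEQUENCE OF A STRATUM SUBSCHEME FORWARD
# (CJS Lemma 3.15 (1) along Kollár's push-forward 3.30.3)

[OURS · L1 W4.2] The first half of the rung FC-R1 of card `fibral-confinement` (CHAIN w42 §4,
row stub-3) and of the confinement stub `stub_confine3` of skeleton v3: **resolving a closed
subscheme of a maximal Hilbert–Samuel stratum INSIDE the ambient scheme.** Let `Y` be reduced and
locally of finite type over a field `k`, `dim Y ≤ N`, `ν ≠ Φ^{(N)}` a value with nothing of `Σ_Y`
strictly above it (e.g. `ν ∈ Σ_Y^max`), and `τ : S ↪ Y` a closed immersion landing in the stratum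
`Y(ν)` (say `S` = a two-dimensional component of `Y(ν)` with its reduced structure). For ANY
blow-up sequence `t` of `S` in regular centres (e.g. the Cossart–Jannsen–Saito resolution
sequence of the surface `S`), Kollár's push-forward `τ_* t` (tree: `CentreSeq.pushforward`,
Kollár 2007, 3.30.3 — blow up `Y` in the same centres, re-embedding the blown-up `S` as the strict
transform at each step) is a blow-up sequence of `Y` whose centres are REGULAR and lie in the
successive `ν`-strata `Y_i(ν)`, and the embedded `S_i` stay inside `Y_i(ν)`:

* `CentreSeq.pushforward_allRegular_centresInStratum_range` — the induction (this file's main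
  theorem). Step: the centre `τ_* Z` is regular (`isRegular_subscheme_map_iff_of_isClosedImmersion`)
  and lies in `τ(S) ⊆ Y(ν)`, hence is PERMISSIBLE
  (`isPermissible_of_isRegular_subscheme_of_support_subset_hsStratum_of_isExcellent`, p478970), so
  `H^N` does not increase under its blow-up (CJS Thm. 3.10 (1), PROVED:
  `CossartJannsenSaito2020_thm_3_10_1_holds`); every point `z` of `S₁ = Bl_Z S` specialises from a
  maximal point `η`, which lies off the exceptional divisor (an effective Cartier divisor contains
  no maximal point: `maximalIdeal_not_mem_minimalPrimes_of_mem_support_of_isEffectiveCartier`), so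
  `Y₁ = Bl_{τ_* Z} Y → Y` is a local isomorphism at `j₁ η` and CJS Lemma 3.15 (1)
  (`Scheme.closure_subset_hsStratum_of_maximal`, with the sharp Thm. 2.33 (1) over a field) puts
  `cl{j₁ η} ∋ j₁ z` inside `Y₁(ν)`.
* `CentreSeq.pushforward_confinementClauses` — consequently (with p478970
  `CentreSeq.confinementClauses_of_allRegular_of_centresInStratum`) `τ_* t` has permissible centres,
  centres over `Y(ν)`, and `H^N` non-increasing along its composite — the clauses of `stub_confine3`
  — and its last embedding `j_r : S_r ↪ Y_r` lands in `Y_r(ν)`, ready for the next round (blow up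
  the regular `S_r` itself).

NOT a statement of any manuscript; AI-written, weaker than expert review.

## Sources

* V. Cossart, U. Jannsen, S. Saito, *Desingularization: Invariants and Strategy*, LNM 2270
  (2020), Thm. 2.33 (1), Def. 3.1, Thm. 3.3, Thm. 3.10 (1), Lemma 3.15 (1), Def. 6.14, Rem. 6.29.
  [CossartJannsenSaito2020]
* J. Kollár, *Lectures on Resolution of Singularities* (2007), 3.30.3. [Kollar2007]
* U. Görtz, T. Wedhorn, *Algebraic Geometry I* (2020), Remark 9.24, Prop. 13.91, 13.96 (2).
  [GortzWedhorn2020]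
* The Stacks Project, Tags 01J7, 02OS. [StacksProject]
-/

set_option linter.dupNamespace false -- mandated namespace of this single-conjunct summit

noncomputable section

open CategoryTheory AlgebraicGeometry TopologicalSpace Topology IsLocalRing
open Literature.AlgebraicGeometry.Resolution Literature.RingTheory.HilbertSamuel

namespace Summit.ResolutionOfSingularities.ResolutionOfSingularities.Theorems.SigmaMaxModificationsCorridor3.Helpers

universe u

/-! ## Maximal points: every point specialises from one, and none lies on an effective Cartier divisor -/

/-- **Every point of a scheme is a specialisation of a maximal point** (a point whose local ring
is zero-dimensional, i.e. whose maximal ideal is a minimal prime): take a minimal prime of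
`𝒪_{X,x}` and its generisation (Stacks 01J7). [cite: StacksProject, Tag 01J7] -/
theorem exists_specializes_maximalIdeal_mem_minimalPrimes {X : Scheme.{u}} (x : X) :
    ∃ η : X, η ⤳ x ∧ maximalIdeal (X.presheaf.stalk η) ∈ minimalPrimes (X.presheaf.stalk η) := by
  obtain ⟨p, hp, -⟩ := Ideal.exists_minimalPrimes_le (I := (⊥ : Ideal (X.presheaf.stalk x)))
    (J := maximalIdeal (X.presheaf.stalk x)) bot_le
  haveI : p.IsPrime := hp.1.1
  obtain ⟨η, h, hη⟩ := exists_specializes_comap_stalkSpecializes_eq x p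
  refine ⟨η, h, (primeOfSpecializes_mem_minimalPrimes_iff h).mp ?_⟩
  change (maximalIdeal (X.presheaf.stalk η)).comap (X.presheaf.stalkSpecializes h).hom ∈ _
  rwa [← hη]

/-- **An effective Cartier divisor passes through no maximal point**: at a point of `V(K)`, `K`
effective Cartier, the local equation is a nonzerodivisor in the maximal ideal, so the maximal
ideal is not a minimal prime (minimal primes consist of zero divisors).
[cite: GortzWedhorn2020, Remark 9.24] -/
theorem maximalIdeal_not_mem_minimalPrimes_of_mem_support_of_isEffectiveCartier {X : Scheme.{u}}
    {K : X.IdealSheafData} (hK : IsEffectiveCartier K) {x : X} (hx : x ∈ K.support) :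
    maximalIdeal (X.presheaf.stalk x) ∉ minimalPrimes (X.presheaf.stalk x) := by
  intro hmin
  obtain ⟨t, ht, hKt⟩ := hK.exists_stalkIdeal_eq_span x
  have htm : t ∈ maximalIdeal (X.presheaf.stalk x) := by
    have h := (mem_support_iff_stalkIdeal_le K x).mp hx
    rw [hKt, Ideal.span_singleton_le_iff_mem] at h
    exact h
  exact notMem_nonZeroDivisors_of_mem_mem_minimalPrimes htm hmin ht

/-! ## The push-forward of a regular-centred sequence of a stratum subscheme -/

/-- **Pushing a blow-up sequence of a closed subscheme of a Hilbert–Samuel stratum forward**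
(Kollár 3.30.3 with CJS Lemma 3.15 (1), Thm. 3.3, Thm. 3.10 (1)). Let `Y` be reduced, locally of
finite type over a field `k`, `dim Y ≤ N`, `ν ≠ Φ^{(N)}` with no value of `Σ_Y(N)` strictly above
`ν`, `τ : S ↪ Y` a closed immersion with `τ(S) ⊆ Y(ν)`, and `t` a blow-up sequence of `S` with
regular centres. Then the push-forward `τ_* t` has regular centres lying in the successive strata
`Y_i(ν)`, and its last embedding `j_r : S_r ↪ Y_r` lands in `Y_r(ν)`.
[cite: CossartJannsenSaito2020, Lemma 3.15 (1), Thm. 3.10 (1), Thm. 3.3]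
[cite: Kollar2007, 3.30.3] -/
theorem CentreSeq.pushforward_allRegular_centresInStratum_range {k : Type u} [Field k] {N : ℕ}
    {ν : ℕ → ℕ} (hν : ν ≠ iterPSum N Phi) :
    ∀ {S Y : Scheme.{u}} (t : CentreSeq S) (τ : S ⟶ Y) [IsClosedImmersion τ]
      (g : Y ⟶ Spec (.of k)) [LocallyOfFiniteType g] [IsReduced Y],
      topologicalKrullDim Y ≤ (N : WithBot ℕ∞) →
      (∀ μ ∈ Scheme.hsValues Y N, ν ≤ μ → μ ≤ ν) →
      Set.range τ.base ⊆ Scheme.hsStratum Y N ν → t.AllRegular →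
        (t.pushforward τ).AllRegular ∧ (t.pushforward τ).CentresInStratum N ν ∧
          Set.range (t.pushforwardι τ).base ⊆ Scheme.hsStratum (t.pushforward τ).top N ν
  | _, Y, CentreSeq.nil _, τ, _, g, _, _, _, _, hτ, _ => ⟨trivial, trivial, hτ⟩
  | S, Y, CentreSeq.cons C' rest, τ, _, g, _, _, hdim, hup, hτ, hreg => by
    obtain ⟨hC'reg, hrestreg⟩ := (CentreSeq.allRegular_cons C' rest).mp hreg
    haveI : IsLocallyNoetherian Y := LocallyOfFiniteType.isLocallyNoetherian g
    have hexc : Scheme.IsExcellent Y :=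
      Scheme.isExcellent_of_locallyOfFiniteType Stacks07QW_field_holds g
    -- the centre `τ_* Z` of `Y`: regular, inside the stratum, hence permissible
    have hCreg : Scheme.IsRegular (C'.map τ).subscheme :=
      (isRegular_subscheme_map_iff_of_isClosedImmersion τ C').mpr hC'reg
    have hCsupp : ((C'.map τ).support : Set Y) ⊆ Scheme.hsStratum Y N ν := by
      rw [coe_support_map_of_isClosedImmersion]
      rintro _ ⟨s, -, rfl⟩
      exact hτ ⟨s, rfl⟩
    have hperm : IdealSheafData.IsPermissible (C'.map τ) :=
      isPermissible_of_isRegular_subscheme_of_support_subset_hsStratum_of_isExcellent hexc hdim hν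
        (C'.map τ) hCreg hCsupp
    -- the blow-up `Y₁ = Bl_{τ_* Z} Y`
    haveI : IsProper (blowup.π (C'.map τ)) := (blowup.isBlowup (C'.map τ)).isProper
    haveI : IsReduced (blowup (C'.map τ)) := (blowup.isBlowup (C'.map τ)).isReduced_of_isReduced
    haveI : IsLocallyNoetherian (blowup (C'.map τ)) :=
      LocallyOfFiniteType.isLocallyNoetherian (blowup.π (C'.map τ) ≫ g)
    have hdim₁ : topologicalKrullDim (blowup (C'.map τ)) ≤ (N : WithBot ℕ∞) :=
      (blowup.isBlowup (C'.map τ)).topologicalKrullDim_le_of_isLocallyNoetherian hdim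
    have hmono₁ : ∀ y₁ : blowup (C'.map τ), Scheme.hsFun (blowup (C'.map τ)) N y₁ ≤
        Scheme.hsFun Y N ((blowup.π (C'.map τ)).base y₁) :=
      hsFun_le_of_isPermissibleBlowup CossartJannsenSaito2020_thm_3_10_1_holds
        ⟨C'.map τ, blowup.isBlowup (C'.map τ), hperm⟩ hexc hdim
    have hup₁ : ∀ μ ∈ Scheme.hsValues (blowup (C'.map τ)) N, ν ≤ μ → μ ≤ ν := by
      rintro μ ⟨y, rfl⟩ hle
      exact (hmono₁ y).trans (hup _ ⟨(blowup.π (C'.map τ)).base y, rfl⟩ (hle.trans (hmono₁ y)))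
    -- the new embedding `j₁ : S₁ = Bl_Z S ↪ Y₁` lands in `Y₁(ν)` (Lemma 3.15 (1))
    have hτ₁ : Set.range (blowup.pushforwardMap C' τ).base ⊆
        Scheme.hsStratum (blowup (C'.map τ)) N ν := by
      rintro _ ⟨z, rfl⟩
      obtain ⟨η, hηz, hηmin⟩ := exists_specializes_maximalIdeal_mem_minimalPrimes z
      -- `η` is off the exceptional divisor of `S₁ → S`
      have hηE : η ∉ (C'.comap (blowup.π C')).support := fun h =>
        maximalIdeal_not_mem_minimalPrimes_of_mem_support_of_isEffectiveCartier
          (blowup.isBlowup C').isEffectiveCartier h hηmin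
      -- `π (j₁ η) = τ (π' η)`
      have hcomm : (blowup.π (C'.map τ)).base ((blowup.pushforwardMap C' τ).base η) =
          τ.base ((blowup.π C').base η) := by
        have h := Scheme.Hom.comp_apply (blowup.pushforwardMap C' τ) (blowup.π (C'.map τ)) η
        rw [blowup.pushforwardMap_π, Scheme.Hom.comp_apply] at h
        exact h.symm
      -- hence `j₁ η` is off the exceptional divisor of `Y₁ → Y`
      have hτηE : (blowup.pushforwardMap C' τ).base η ∉
          ((C'.map τ).comap (blowup.π (C'.map τ))).support := by
        intro h
        apply hηE
        rw [Scheme.IdealSheafData.support_comap] at h ⊢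
        change (blowup.π (C'.map τ)).base ((blowup.pushforwardMap C' τ).base η) ∈
          ((C'.map τ).support : Set Y) at h
        change (blowup.π C').base η ∈ (C'.support : Set S)
        rw [hcomm] at h
        exact (apply_mem_support_map_iff τ C' _).mp h
      haveI : IsIso ((blowup.π (C'.map τ)).stalkMap ((blowup.pushforwardMap C' τ).base η)) :=
        (blowup.isBlowup (C'.map τ)).isIso_stalkMap_of_not_mem_exceptional hτηE
      have hval : Scheme.hsFun Y N
          ((blowup.π (C'.map τ)).base ((blowup.pushforwardMap C' τ).base η)) = ν := by
        rw [hcomm]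
        exact hτ ⟨_, rfl⟩
      have hmax : Maximal (· ∈ Scheme.hsValues Y N) (Scheme.hsFun Y N
          ((blowup.π (C'.map τ)).base ((blowup.pushforwardMap C' τ).base η))) := by
        rw [hval]
        exact ⟨⟨_, hval⟩, fun μ hμ hle => hup μ hμ hle⟩
      have h233 : ∀ x' : blowup (C'.map τ), (blowup.pushforwardMap C' τ).base η ⤳ x' →
          Scheme.hsFun (blowup (C'.map τ)) N ((blowup.pushforwardMap C' τ).base η) ≤
            Scheme.hsFun (blowup (C'.map τ)) N x' := fun x' h =>
        Scheme.hsFun_le_hsFun_of_specializes_over_field (blowup.π (C'.map τ) ≫ g) N h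
      have hcl := (Scheme.closure_subset_hsStratum_of_maximal (blowup.π (C'.map τ)) N hmono₁
        hmax h233).1
      rw [hval] at hcl
      exact hcl (specializes_iff_mem_closure.mp
        (hηz.map (blowup.pushforwardMap C' τ).continuous))
    -- recursion on the tail, along `j₁`
    have ih := CentreSeq.pushforward_allRegular_centresInStratum_range hν rest
      (blowup.pushforwardMap C' τ) (blowup.π (C'.map τ) ≫ g) hdim₁ hup₁ hτ₁ hrestreg
    exact ⟨(CentreSeq.allRegular_cons _ _).mpr ⟨hCreg, ih.1⟩,
      (CentreSeq.centresInStratum_cons _ _).mpr ⟨hCsupp, ih.2.1⟩, ih.2.2⟩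

/-- **The confinement clauses for a pushed-forward sequence.** In the situation of
`CentreSeq.pushforward_allRegular_centresInStratum_range` with `ν` MAXIMAL in `Σ_Y(N)`: the
push-forward `τ_* t` has regular, permissible centres lying over `Y(ν)`, `H^N` does not increase
along its composite, and `j_r(S_r) ⊆ Y_r(ν)` — i.e. `τ_* t` satisfies the clauses `hreg`, `hover`,
`hmono` of the v3 stubs `stub_confine3` / `stub_confinedTameNu3_of_thor4` / `stub_confinedWildNu3`
(p478970 `CentreSeq.confinementClauses_of_allRegular_of_centresInStratum`).
[cite: CossartJannsenSaito2020, Def. 6.14, Lemma 3.15 (1), Thm. 3.10 (1)] [cite: Kollar2007, 3.30.3] -/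
theorem CentreSeq.pushforward_confinementClauses {k : Type u} [Field k] {N : ℕ} {ν : ℕ → ℕ}
    (hν : ν ≠ iterPSum N Phi) {S Y : Scheme.{u}} (t : CentreSeq S) (τ : S ⟶ Y)
    [IsClosedImmersion τ] (g : Y ⟶ Spec (.of k)) [LocallyOfFiniteType g] [IsReduced Y]
    (hdim : topologicalKrullDim Y ≤ (N : WithBot ℕ∞))
    (hmax : Maximal (· ∈ Scheme.hsValues Y N) ν)
    (hτ : Set.range τ.base ⊆ Scheme.hsStratum Y N ν) (hreg : t.AllRegular) :
    (t.pushforward τ).AllRegular ∧ (t.pushforward τ).AllPermissible ∧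
      (t.pushforward τ).CentresOver (Scheme.hsStratum Y N ν) ∧
      (∀ x' : (t.pushforward τ).top,
        Scheme.hsFun (t.pushforward τ).top N x' ≤ Scheme.hsFun Y N ((t.pushforward τ).comp.base x')) ∧
      Set.range (t.pushforwardι τ).base ⊆ Scheme.hsStratum (t.pushforward τ).top N ν := by
  haveI : IsLocallyNoetherian Y := LocallyOfFiniteType.isLocallyNoetherian g
  have hexc : Scheme.IsExcellent Y :=
    Scheme.isExcellent_of_locallyOfFiniteType Stacks07QW_field_holds g
  obtain ⟨hreg', hstr, hrange⟩ := CentreSeq.pushforward_allRegular_centresInStratum_range hν t τ g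
    hdim (fun μ hμ hle => hmax.2 hμ hle) hτ hreg
  obtain ⟨hperm, hover, hmono⟩ :=
    CentreSeq.confinementClauses_of_allRegular_of_centresInStratum (t.pushforward τ) hexc hdim hν
      hmax hreg' hstr
  exact ⟨hreg', hperm, hover, hmono, hrange⟩

end Summit.ResolutionOfSingularities.ResolutionOfSingularities.Theorems.SigmaMaxModificationsCorridor3.Helpers

end
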